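import Mathlib
import Summits.Ventures.PercRepro2.GoodCoordinate
import Summits.Ventures.PercRepro2.AS3Cases

/-!
# The sectioning tree of a STEP(0,3) pair and the conjecture (GC-STEP)
(seat mine-b, cell pub-perc-repro2; conjectures/MINE-B.md §15 Addendum 10)

For a clutter `B` the unpinned STEP(0,3) inequality is (AS3) for the pair `(B □ B, B)` (`stepH_zero_of_AS3`
for graphs; `absH` for clutters). The good-coordinate induction `AS3_of_goodCoordinate_family` only needs
the «good» branch on the pairs that the cross sections generate from the root: the SECTIONING TREE of
`(B □ B, B)`, defined here as the inductive predicate `InTree B`, closed under cross sections by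
construction (`inTree_closed`).

* `AS3_of_goodCoordinate_tree` — if every pair of the tree of `B` on a nonempty cube satisfies (AS3) or has
  a good coordinate, then (AS3) holds on every pair of the tree, in particular at the root: `AS3 U (DOcc B B) B`
  for every cube `U` — the i = 0 row STEP(0,3) of the clutter `B` on every pattern.

The hypothesis is the conjecture (GC-STEP) of MINE-B.md §15 Addendum 10 (every node of every tree reached by
the backtracking descent had a good coordinate on ≈ 1.6 M nodes of ≈ 100,000 random clutters on 6–7
elements, while for GENERAL nested pairs the good-coordinate lemma is false on 6 elements, NEG-B17);
nothing here depends on it.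
-/

open Finset

namespace Summit.Ventures.PercRepro2

namespace StepZero

open ReimerCube

variable {E : Type*} [DecidableEq E]

open Classical

/-- the sectioning tree of the STEP(0,3) pair of a clutter `B`: the root `(B □ B, B)` on any cube, and the
two cross sections of every member -/
inductive InTree (B : Finset E → Prop) : Finset E → (Finset E → Prop) → (Finset E → Prop) → Prop
  | root (U : Finset E) : InTree B U (DOcc B B) B
  | left {U' : Finset E} {i : E} {A C : Finset E → Prop} (hi : i ∉ U') (h : InTree B (insert i U') A C) :
      InTree B U' A (sec1 i C)
  | right {U' : Finset E} {i : E} {A C : Finset E → Prop} (hi : i ∉ U') (h : InTree B (insert i U') A C) :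
      InTree B U' (sec1 i A) C

/-- the tree is closed under the cross sections -/
lemma inTree_closed (B : Finset E → Prop) (U' : Finset E) (i : E) (A C : Finset E → Prop) (hi : i ∉ U')
    (h : InTree B (insert i U') A C) : InTree B U' A (sec1 i C) ∧ InTree B U' (sec1 i A) C :=
  ⟨InTree.left hi h, InTree.right hi h⟩

omit [DecidableEq E] in
/-- `B □ B` is increasing for increasing `B` -/
lemma incr_dOcc_self {B : Finset E → Prop} : Incr (DOcc B B) := by
  intro S T hST h
  obtain ⟨K, L, hK, hL, hd, hB1, hB2⟩ := h
  exact ⟨K, L, hK.trans hST, hL.trans hST, hd, hB1, hB2⟩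

/-- every member of the tree consists of increasing events -/
lemma inTree_incr {B : Finset E → Prop} (hB : Incr B) {U : Finset E} {A C : Finset E → Prop}
    (h : InTree B U A C) : Incr A ∧ Incr C := by
  induction h with
  | root U => exact ⟨incr_dOcc_self, hB⟩
  | left hi _ ih => exact ⟨ih.1, incr_sec1 ih.2 _⟩
  | right hi _ ih => exact ⟨incr_sec1 ih.1 _, ih.2⟩

/-- **(GC-STEP) ⟹ STEP(0,3) for the clutter `B`**: if every pair of the sectioning tree of `B` on a
nonempty cube satisfies (AS3) or has a good coordinate, then `AS3 U (DOcc B B) B` for every cube `U`. -/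
theorem AS3_of_goodCoordinate_tree {B : Finset E → Prop} (hB : Incr B)
    (hGC : ∀ (U : Finset E) (A C : Finset E → Prop), InTree B U A C → U.Nonempty →
      AS3 U A C ∨ ∃ i ∈ U, cN (U.erase i) A C i ≤ cD (U.erase i) A C i + cE (U.erase i) A C i) :
    ∀ U : Finset E, AS3 U (DOcc B B) B := by
  intro U
  refine AS3_of_goodCoordinate_family (InTree B) (fun U' i A C hi h => inTree_closed B U' i A C hi h)
    ?_ U (DOcc B B) B (InTree.root U) incr_dOcc_self hB
  intro V A C hV _ _ hne
  exact hGC V A C hV hne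

/-! ## Certificates: the backtracking descent as an inductive predicate -/

/-- a CERTIFICATE for (AS3) at `(U; A, B)`: either a directly known case, or a good coordinate `i` whose two
cross pairs are certified — exactly the object found by the backtracking descent (steptree.c) -/
inductive Cert : Finset E → (Finset E → Prop) → (Finset E → Prop) → Prop
  | base {U : Finset E} {A B : Finset E → Prop} (h : AS3 U A B) : Cert U A B
  | step {U : Finset E} {A B : Finset E → Prop} {i : E} (hi : i ∈ U)
      (hgood : cN (U.erase i) A B i ≤ cD (U.erase i) A B i + cE (U.erase i) A B i)
      (h1 : Cert (U.erase i) A (sec1 i B)) (h2 : Cert (U.erase i) (sec1 i A) B) : Cert U A B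

/-- **a certificate proves (AS3)** (for increasing events) -/
theorem AS3_of_cert {U : Finset E} {A B : Finset E → Prop} (hA : Incr A) (hB : Incr B)
    (h : Cert U A B) : AS3 U A B := by
  induction h with
  | base h => exact h
  | @step U A B i hi hgood _ _ ih1 ih2 =>
    have hi' : i ∉ U.erase i := Finset.notMem_erase i U
    have hU' : insert i (U.erase i) = U := Finset.insert_erase hi
    have h1 := (AS3_iff_Phi_nonneg _ _ _).mp (ih1 hA (incr_sec1 hB i))
    have h2 := (AS3_iff_Phi_nonneg _ _ _).mp (ih2 (incr_sec1 hA i) hB)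
    rw [AS3_iff_Phi_nonneg, ← hU', Phi_insert (U.erase i) hi' hA hB]
    have hg : (cN (U.erase i) A B i : ℤ) ≤ cD (U.erase i) A B i + cE (U.erase i) A B i := by
      exact_mod_cast hgood
    linarith

/-- **STEP(0,3) of the clutter `B` from a certificate at the root** — the conjecture (GC-STEP′) of
MINE-B.md §15 Addendum 10 is `∀ U, Cert U (DOcc B B) B` (the backtracking descent found such a certificate
for every clutter tested on ≤ 7 elements). -/
theorem AS3_root_of_cert {B : Finset E → Prop} (hB : Incr B) (U : Finset E)
    (h : Cert U (DOcc B B) B) : AS3 U (DOcc B B) B :=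
  AS3_of_cert incr_dOcc_self hB h

end StepZero

end Summit.Ventures.PercRepro2
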